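import Summits.NavierStokesRegularity.OSWSelfSimilar.CertificateViscousSheetRChain
import Mathlib.Topology.MetricSpace.Contracting
import HarnessLib

/-!
# Z3-SR-CERT: the row's sentence in FIXED-POINT form — the linear part `DG(Ω̄)` enters only through its bounded inverse `S : X* → E`

HONEST FRAMING (cell ns-blowup GROUP B, zone Z3, case Z3-SR-CERT; 1-D MODEL (viscous gCLM/OSW sheet on `ℝ` at `c_l = 1/2`),
computer-assisted; not Euler, not Navier–Stokes; «violates: none — MODEL»).  Companion of `CertificateViscousSheetR.lean` (the row's
literals `K, Llip, eta, h, rE` and `norm_num` facts) and `CertificateViscousSheetRChain.lean` (`existsUnique_zero_of_row(_quadratic)`).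

WHY THIS FILE.  `existsUnique_zero_of_row_quadratic` asks for the certificate map as `G u = g₀ + A u + Q u u` with a BOUNDED linear part
`A : E →L[ℝ] E*` (and the chain's coercive part as a bounded bilinear form `B`).  For the sheet this hypothesis cannot be met: in the frame
of record (`E = odd H¹_w`, `‖δ‖²_E = ‖δ′‖²_w + ¼‖δ‖²_w`, `w = L² + ξ²`, dual pairing `⟨f, wφ⟩`, PRICE-impl1 §1) the backbone term `½ξ∂_ξ`
of `B₀ = 1 + ½ξ∂ − ∂²` gives the bilinear form `(u, φ) ↦ ½∫ w ξ u′ φ`, which is UNBOUNDED on `E × E` (odd bump pairs at `±R`: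
form `∼ R³`, norms `∼ R·R`), so `DG(Ω̄) = B_λ − P` is not an element of `B(E, E*)`.  What the certificate actually uses is only the
INVERSE `S := DG(Ω̄)⁻¹ : X* → E` (`‖S‖ ≤ K`), the bilinear bound `‖Q u v‖_{X*} ≤ M‖u‖_E‖v‖_E` (`L_lip = 2M`) and `η ≥ ‖G(Ω̄)‖_{X*}`:
the simplified-Newton map `T(δ) = −S(G(Ω̄) + Q δ δ)` is a self-map and a contraction of the closed `E`-ball of every radius
`r ∈ [(1 − √(1 − 2h))/(K L_lip), 1/(K L_lip))`, `h = K²L_lipη < ½` — with EXACTLY the row's constants.  This file proves that statement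
abstractly (`existsUnique_fixedPoint_quadratic`, Banach's fixed point theorem; no differentiability, no bounded linear part) and composes it with
the row's literals (`existsUnique_fixedPoint_of_row`): in the closed `E`-ball of radius `rE` about `0` there is EXACTLY ONE `δ` with
`δ = −S(g₀ + Q δ δ)`.  Reading: `Ω* = Ω̄ + δ`, and «`G(Ω*) = 0` in `X*`» means `DG(Ω̄)δ = −(G(Ω̄) + Q δ δ)`, i.e. `δ = −S(…)` with `S` the
solution operator of `DG(Ω̄)` ((C1)–(C3)).  WHAT IS (STILL) NOT KERNEL-CHECKED: the interval arithmetic behind the literals and the MODEL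
ASSEMBLY (that the sheet's solution operator `S`, quadratic part `Q` and residual `g₀ = G(Ω̄)` satisfy the three bounds).  No definition, no
`Prop` fact; no number or word of the cell changes.  WHAT THIS IS NOT: not NS.
-/

noncomputable section

open Metric Set

namespace Summit.NavierStokesRegularity.OSWSelfSimilar
namespace CertificateViscousSheetR

open Literature.Analysis.Calculus

variable {E : Type*} [NormedAddCommGroup E] [NormedSpace ℝ E] [CompleteSpace E]
variable {Xs : Type*} [NormedAddCommGroup Xs] [NormedSpace ℝ Xs]

/-- **Simplified Newton / Banach fixed point with the linear part given only through its inverse.**  Let `E` be a real Banach space,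
`Xs` a real normed space, `S : Xs →L E` with `‖Sφ‖ ≤ K‖φ‖` (`K > 0`), `Q : E →L E →L Xs` with `‖Q u v‖ ≤ M‖u‖‖v‖` (`M > 0`), `g₀ ∈ Xs`
with `‖g₀‖ ≤ η`.  If `h := K²(2M)η` satisfies `2h < 1` and the radius `r` satisfies `(1 − √(1 − 2h))/(K·2M) ≤ r` and `r·K·(2M) < 1`, then the
closed ball `‖δ‖ ≤ r` contains EXACTLY ONE solution of `δ = −S(g₀ + Q δ δ)` (the map `δ ↦ −S(g₀ + Qδδ)` maps the ball into itself —
`K(η + Mr²) ≤ r` between the Kantorovich radii — and is an `rK(2M)`-contraction there). [folklore] -/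
theorem existsUnique_fixedPoint_quadratic (S : Xs →L[ℝ] E) (Q : E →L[ℝ] E →L[ℝ] Xs) (g₀ : Xs) {K M η r : ℝ}
    (hK : 0 < K) (hM : 0 < M) (hS : ∀ φ, ‖S φ‖ ≤ K * ‖φ‖) (hQ : ∀ u v, ‖Q u v‖ ≤ M * ‖u‖ * ‖v‖) (hg : ‖g₀‖ ≤ η)
    (hh : 2 * (K ^ 2 * (2 * M) * η) < 1) (hr : (1 - Real.sqrt (1 - 2 * (K ^ 2 * (2 * M) * η))) / (K * (2 * M)) ≤ r)
    (hr' : r * K * (2 * M) < 1) :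
    ∃ δ ∈ closedBall (0 : E) r, δ = -S (g₀ + Q δ δ) ∧ ∀ δ' ∈ closedBall (0 : E) r, δ' = -S (g₀ + Q δ' δ') → δ' = δ := by
  have hη : 0 ≤ η := (norm_nonneg _).trans hg
  set s : ℝ := Real.sqrt (1 - 2 * (K ^ 2 * (2 * M) * η)) with hs
  have hKM : 0 < K * (2 * M) := by positivity
  have hs0 : 0 ≤ s := Real.sqrt_nonneg _
  have hs2 : s ^ 2 = 1 - 2 * (K ^ 2 * (2 * M) * η) := Real.sq_sqrt (by linarith)
  -- the scaled radius `t = 2KMr ∈ [1 − s, 1)`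
  set t : ℝ := r * K * (2 * M) with ht
  have ht1 : 1 - s ≤ t := by
    have := (div_le_iff₀ hKM).1 hr
    rw [ht]; linarith
  have ht2 : t < 1 := hr'
  have hr0 : 0 ≤ r := by
    have hprod : 0 ≤ K ^ 2 * (2 * M) * η := by positivity
    have hs1 : s ≤ 1 := Real.sqrt_le_one.2 (by linarith)
    have h1s : 0 ≤ 1 - s := by linarith
    exact le_trans (div_nonneg h1s hKM.le) hr
  -- self-map inequality `K(η + M r²) ≤ r`
  have hself : K * (η + M * r ^ 2) ≤ r := by
    have h1t : 0 ≤ 1 - t := by linarith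
    have hkey : (1 - t) ^ 2 ≤ s ^ 2 := pow_le_pow_left₀ h1t (by linarith) 2
    rw [hs2] at hkey
    -- (1 − t)² ≤ 1 − 4K²Mη  ⇔  K·2M·(Kη + KMr²) ≤ t
    have e : K * (2 * M) * (K * (η + M * r ^ 2)) = 2 * (K ^ 2 * (2 * M) * η) / 2 + t ^ 2 / 2 := by rw [ht]; ring
    have h2 : K * (2 * M) * (K * (η + M * r ^ 2)) ≤ K * (2 * M) * r := by
      rw [e, show K * (2 * M) * r = t by rw [ht]; ring]
      nlinarith
    exact le_of_mul_le_mul_left h2 hKM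
  -- the map and its properties
  set T : E → E := fun δ => -S (g₀ + Q δ δ) with hT
  have hmaps : MapsTo T (closedBall (0 : E) r) (closedBall (0 : E) r) := by
    intro δ hδ
    rw [mem_closedBall, dist_zero_right] at hδ ⊢
    calc ‖T δ‖ = ‖S (g₀ + Q δ δ)‖ := by rw [hT]; exact norm_neg _
      _ ≤ K * ‖g₀ + Q δ δ‖ := hS _
      _ ≤ K * (‖g₀‖ + ‖Q δ δ‖) := by gcongr; exact norm_add_le _ _
      _ ≤ K * (η + M * ‖δ‖ * ‖δ‖) := by gcongr; exact hQ δ δ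
      _ ≤ K * (η + M * r ^ 2) := by
          gcongr K * (η + ?_)
          have := mul_le_mul hδ hδ (norm_nonneg _) hr0
          nlinarith [hM.le]
      _ ≤ r := hself
  have hlip : ∀ x ∈ closedBall (0 : E) r, ∀ y ∈ closedBall (0 : E) r, ‖T y - T x‖ ≤ t * ‖y - x‖ := by
    intro x hx y hy
    rw [mem_closedBall, dist_zero_right] at hx hy
    have e : T y - T x = -S (Q y (y - x) + Q (y - x) x) := by
      simp only [hT, map_sub, map_add, sub_apply]
      abel
    rw [e, norm_neg]
    calc ‖S (Q y (y - x) + Q (y - x) x)‖ ≤ K * ‖Q y (y - x) + Q (y - x) x‖ := hS _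
      _ ≤ K * (‖Q y (y - x)‖ + ‖Q (y - x) x‖) := by gcongr; exact norm_add_le _ _
      _ ≤ K * (M * ‖y‖ * ‖y - x‖ + M * ‖y - x‖ * ‖x‖) := by gcongr <;> exact hQ _ _
      _ ≤ K * (M * r * ‖y - x‖ + M * ‖y - x‖ * r) := by gcongr
      _ = t * ‖y - x‖ := by rw [ht]; ring
  have ht0 : 0 ≤ t := by rw [ht]; positivity
  obtain ⟨Kc, hKc⟩ : ∃ Kc : NNReal, (Kc : ℝ) = t := ⟨⟨t, ht0⟩, rfl⟩
  have hKc1 : Kc < 1 := by rw [← NNReal.coe_lt_coe, hKc, NNReal.coe_one]; exact ht2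
  have hlipK : LipschitzOnWith Kc T (closedBall (0 : E) r) := by
    refine LipschitzOnWith.of_dist_le_mul fun x hx y hy => ?_
    rw [dist_eq_norm, dist_eq_norm, hKc]
    exact hlip y hy x hx
  have hc : ContractingWith Kc (hmaps.restrict T _ _) := ⟨hKc1, hlipK.mapsToRestrict hmaps⟩
  obtain ⟨δ, hδ, hfix, -, -⟩ :=
    hc.exists_fixedPoint' isClosed_closedBall.isComplete hmaps (mem_closedBall_self hr0) (edist_ne_top _ _)
  refine ⟨δ, hδ, hfix.symm, fun δ' hδ' hfix' => ?_⟩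
  have hle : ‖δ' - δ‖ ≤ t * ‖δ' - δ‖ := by
    have := hlip δ hδ δ' hδ'
    have hT' : T δ' = δ' := by simp only [hT]; exact hfix'.symm
    rwa [hT', show T δ = δ from hfix] at this
  have h0 : ‖δ' - δ‖ = 0 := by nlinarith [norm_nonneg (δ' - δ)]
  exact sub_eq_zero.1 (norm_eq_zero.1 h0)

/-- **The row's sentence, fixed-point form.**  For ANY real Banach space `E`, normed space `Xs` (the dual `X*` of the frame), solution
operator `S : Xs →L E` of `DG(Ω̄)` with `‖Sφ‖ ≤ K‖φ‖` (`K` = the row literal), quadratic part `Q` with `‖Q u v‖ ≤ M‖u‖‖v‖`, `2M ≤ Llip`,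
and residual `‖g₀‖ ≤ eta`: the closed `E`-ball of radius `rE` about `0` contains EXACTLY ONE solution of `δ = −S(g₀ + Q δ δ)`
(kernel steps: `K²(2M)‖g₀‖ ≤ K²·Llip·eta ≤ h < ½` by `h_ge`/`h_lt_half`; the Kantorovich radius `≤ 2K‖g₀‖ ≤ 2K·eta ≤ rE` by
`kantorovich_radius_le`/`rE_ge`; the contraction window `rE·K·(2M) ≤ rE·K·Llip < 1` by `rE_mul_K_mul_Llip_lt_one`).  MODEL; the interval
data and the instantiation of `(S, Q, g₀)` by the sheet are hypotheses. [folklore] -/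
theorem existsUnique_fixedPoint_of_row (S : Xs →L[ℝ] E) (Q : E →L[ℝ] E →L[ℝ] Xs) (g₀ : Xs) {M : ℝ} (hM : 0 < M)
    (hS : ∀ φ, ‖S φ‖ ≤ (K : ℝ) * ‖φ‖) (hQ : ∀ u v, ‖Q u v‖ ≤ M * ‖u‖ * ‖v‖) (hLlip : 2 * M ≤ (Llip : ℝ))
    (hη : ‖g₀‖ ≤ (eta : ℝ)) :
    ∃ δ ∈ closedBall (0 : E) (rE : ℝ), δ = -S (g₀ + Q δ δ) ∧
      ∀ δ' ∈ closedBall (0 : E) (rE : ℝ), δ' = -S (g₀ + Q δ' δ') → δ' = δ := by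
  obtain ⟨hKpos, hLlippos, heta0, -, -⟩ := K_pos_and_Llip_pos
  have hKposR : (0 : ℝ) < (K : ℝ) := by exact_mod_cast hKpos
  have hetaR : (0 : ℝ) ≤ (eta : ℝ) := by exact_mod_cast heta0
  have hhge : (K : ℝ) ^ 2 * (Llip : ℝ) * (eta : ℝ) ≤ (h : ℝ) := by have h' := h_ge; exact_mod_cast h'
  have hhlt : 2 * ((h : ℚ) : ℝ) < 1 := by
    have h' : 2 * h < 1 := by have := h_lt_half; linarith
    exact_mod_cast h'
  have hrEge : 2 * (K : ℝ) * (eta : ℝ) ≤ (rE : ℝ) := by have h' := rE_ge; exact_mod_cast h'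
  have hwin : (rE : ℝ) * (K : ℝ) * (Llip : ℝ) < 1 := by have h' := rE_mul_K_mul_Llip_lt_one; exact_mod_cast h'
  have hg0 : 0 ≤ ‖g₀‖ := norm_nonneg _
  -- the actual discriminant is below the row's `h`
  have hK2 : (0 : ℝ) ≤ (K : ℝ) ^ 2 := sq_nonneg _
  have hle : (K : ℝ) ^ 2 * (2 * M) * ‖g₀‖ ≤ (K : ℝ) ^ 2 * (Llip : ℝ) * (eta : ℝ) := by
    have h1 : (K : ℝ) ^ 2 * (2 * M) ≤ (K : ℝ) ^ 2 * (Llip : ℝ) := mul_le_mul_of_nonneg_left hLlip hK2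
    exact mul_le_mul h1 hη hg0 (by positivity)
  have hh : 2 * ((K : ℝ) ^ 2 * (2 * M) * ‖g₀‖) < 1 := by linarith
  -- Kantorovich radius ≤ 2K‖g₀‖ ≤ 2K·eta ≤ rE
  have hr : (1 - Real.sqrt (1 - 2 * ((K : ℝ) ^ 2 * (2 * M) * ‖g₀‖))) / ((K : ℝ) * (2 * M)) ≤ (rE : ℝ) := by
    refine (kantorovich_radius_le hKposR (by positivity) hg0 hh.le).trans ?_
    calc 2 * (K : ℝ) * ‖g₀‖ ≤ 2 * (K : ℝ) * (eta : ℝ) := by gcongr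
      _ ≤ (rE : ℝ) := hrEge
  -- contraction window
  have hrE0 : (0 : ℝ) ≤ (rE : ℝ) := le_trans (by positivity) hrEge
  have hr' : (rE : ℝ) * (K : ℝ) * (2 * M) < 1 := by
    calc (rE : ℝ) * (K : ℝ) * (2 * M) ≤ (rE : ℝ) * (K : ℝ) * (Llip : ℝ) :=
          mul_le_mul_of_nonneg_left hLlip (mul_nonneg hrE0 hKposR.le)
      _ < 1 := hwin
  exact existsUnique_fixedPoint_quadratic S Q g₀ hKposR hM hS hQ le_rfl hh hr hr'


/-! ### Append (selfsim g9, same session): the SELF-MAP form, and the row's sentence keyed on `L²_w` instead of `X*`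

The proof of `existsUnique_fixedPoint_quadratic` uses the radius `r` only through the self-map inequality `K(η + Mr²) ≤ r` and the contraction
window `rK(2M) < 1`; stating it that way (`existsUnique_fixedPoint_quadratic_of_selfMap`) makes the sentence monotone in `(M, η)` and lets the pivot
space be `L²_w` itself rather than the dual `X*`: with `Xs := L²_w` the certificate's own constants are `‖DG(Ω̄)⁻¹‖_{L²_w→E} ≤ K_w := KNw/(1 − KNw·epsN)`
((C3)'s Neumann step in the `w → E` norm: `DG = DG_N − Π_T P`, `‖DG_N⁻¹‖_{w→E} ≤ KNw`, `‖Π_T P‖_{E→L²_w} ≤ epsN`) and `‖Q u v‖_w ≤ (M/2)‖u‖_E‖v‖_E` with PRICE's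
`M = Llip/2` (the pairing bound of `SheetREnergyClassBilinear` loses exactly the factor `‖φ‖_w ≤ 2‖φ‖_E`), i.e. `4·M_w ≤ Llip`; and the two rational
inequalities `K_w·(eta + (Llip/4)·rE²) ≤ rE`, `rE·K_w·(Llip/2) < 1` hold at the literals (`Kw_selfMap_le`, `Kw_window_lt_one`).  Upshot
(`existsUnique_fixedPoint_of_row_w`): a concrete MODEL ASSEMBLY may take the pivot space to be the weighted `L²` space (a Mathlib `Lp` space) — no dual
space is needed — and still land in the row's ball `rE`.  MODEL bookkeeping; no number of the cell changes; not NS. -/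

/-- **Fixed point, self-map form.**  `E` Banach, `Xs` normed, `‖Sφ‖ ≤ K‖φ‖`, `‖Q u v‖ ≤ M‖u‖‖v‖` (`M ≥ 0`), `‖g₀‖ ≤ η`, and a radius `r ≥ 0` with
`K(η + Mr²) ≤ r` (self-map) and `r·K·(2M) < 1` (contraction): the closed ball `‖δ‖ ≤ r` contains EXACTLY ONE solution of `δ = −S(g₀ + Qδδ)`. [folklore] -/
theorem existsUnique_fixedPoint_quadratic_of_selfMap (S : Xs →L[ℝ] E) (Q : E →L[ℝ] E →L[ℝ] Xs) (g₀ : Xs) {K M η r : ℝ}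
    (hK : 0 ≤ K) (hM : 0 ≤ M) (hS : ∀ φ, ‖S φ‖ ≤ K * ‖φ‖) (hQ : ∀ u v, ‖Q u v‖ ≤ M * ‖u‖ * ‖v‖) (hg : ‖g₀‖ ≤ η)
    (hr0 : 0 ≤ r) (hself : K * (η + M * r ^ 2) ≤ r) (hr' : r * K * (2 * M) < 1) :
    ∃ δ ∈ closedBall (0 : E) r, δ = -S (g₀ + Q δ δ) ∧ ∀ δ' ∈ closedBall (0 : E) r, δ' = -S (g₀ + Q δ' δ') → δ' = δ := by
  set t : ℝ := r * K * (2 * M) with ht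
  have ht2 : t < 1 := hr'
  set T : E → E := fun δ => -S (g₀ + Q δ δ) with hT
  have hmaps : MapsTo T (closedBall (0 : E) r) (closedBall (0 : E) r) := by
    intro δ hδ
    rw [mem_closedBall, dist_zero_right] at hδ ⊢
    calc ‖T δ‖ = ‖S (g₀ + Q δ δ)‖ := by rw [hT]; exact norm_neg _
      _ ≤ K * ‖g₀ + Q δ δ‖ := hS _
      _ ≤ K * (‖g₀‖ + ‖Q δ δ‖) := by gcongr; exact norm_add_le _ _
      _ ≤ K * (η + M * ‖δ‖ * ‖δ‖) := by gcongr; exact hQ δ δ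
      _ ≤ K * (η + M * r ^ 2) := by
          gcongr K * (η + ?_)
          have := mul_le_mul hδ hδ (norm_nonneg _) hr0
          nlinarith [hM]
      _ ≤ r := hself
  have hlip : ∀ x ∈ closedBall (0 : E) r, ∀ y ∈ closedBall (0 : E) r, ‖T y - T x‖ ≤ t * ‖y - x‖ := by
    intro x hx y hy
    rw [mem_closedBall, dist_zero_right] at hx hy
    have e : T y - T x = -S (Q y (y - x) + Q (y - x) x) := by
      simp only [hT, map_sub, map_add, sub_apply]
      abel
    rw [e, norm_neg]
    calc ‖S (Q y (y - x) + Q (y - x) x)‖ ≤ K * ‖Q y (y - x) + Q (y - x) x‖ := hS _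
      _ ≤ K * (‖Q y (y - x)‖ + ‖Q (y - x) x‖) := by gcongr; exact norm_add_le _ _
      _ ≤ K * (M * ‖y‖ * ‖y - x‖ + M * ‖y - x‖ * ‖x‖) := by gcongr <;> exact hQ _ _
      _ ≤ K * (M * r * ‖y - x‖ + M * ‖y - x‖ * r) := by gcongr
      _ = t * ‖y - x‖ := by rw [ht]; ring
  have ht0 : 0 ≤ t := by rw [ht]; positivity
  obtain ⟨Kc, hKc⟩ : ∃ Kc : NNReal, (Kc : ℝ) = t := ⟨⟨t, ht0⟩, rfl⟩
  have hKc1 : Kc < 1 := by rw [← NNReal.coe_lt_coe, hKc, NNReal.coe_one]; exact ht2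
  have hlipK : LipschitzOnWith Kc T (closedBall (0 : E) r) := by
    refine LipschitzOnWith.of_dist_le_mul fun x hx y hy => ?_
    rw [dist_eq_norm, dist_eq_norm, hKc]
    exact hlip y hy x hx
  have hc : ContractingWith Kc (hmaps.restrict T _ _) := ⟨hKc1, hlipK.mapsToRestrict hmaps⟩
  obtain ⟨δ, hδ, hfix, -, -⟩ :=
    hc.exists_fixedPoint' isClosed_closedBall.isComplete hmaps (mem_closedBall_self hr0) (edist_ne_top _ _)
  refine ⟨δ, hδ, hfix.symm, fun δ' hδ' hfix' => ?_⟩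
  have hle : ‖δ' - δ‖ ≤ t * ‖δ' - δ‖ := by
    have := hlip δ hδ δ' hδ'
    have hT' : T δ' = δ' := by simp only [hT]; exact hfix'.symm
    rwa [hT', show T δ = δ from hfix] at this
  have h0 : ‖δ' - δ‖ = 0 := by nlinarith [norm_nonneg (δ' - δ)]
  exact sub_eq_zero.1 (norm_eq_zero.1 h0)

/-- At the literals: `K_w·(eta + (Llip/4)·rE²) ≤ rE` with `K_w = KNw/(1 − KNw·epsN)` (`≈ 9.7439·9.0708e-7 = 8.84e-6 ≤ 1.189e-5`). [folklore] -/
theorem Kw_selfMap_le : KNw / (1 - KNw * epsN) * (eta + Llip / 4 * rE ^ 2) ≤ rE := by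
  norm_num [KNw, epsN, eta, Llip, rE]

/-- At the literals: `rE·K_w·(Llip/2) < 1` (`≈ 1.11e-4`). [folklore] -/
theorem Kw_window_lt_one : rE * (KNw / (1 - KNw * epsN)) * (Llip / 2) < 1 := by
  norm_num [KNw, epsN, Llip, rE]

/-- `K_w = KNw/(1 − KNw·epsN)` is positive. [folklore] -/
theorem Kw_pos : 0 < KNw / (1 - KNw * epsN) := by norm_num [KNw, epsN]

/-- **The row's sentence keyed on the weighted `L²` space.**  For ANY real Banach space `E` and normed space `W` (the role of `L²_w`), solution
operator `S : W →L E` of `DG(Ω̄)` with `‖Sg‖_E ≤ K_w‖g‖_W`, `K_w = KNw/(1 − KNw·epsN)`, quadratic part with `‖Q u v‖_W ≤ M_w‖u‖‖v‖`, `4M_w ≤ Llip`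
(PRICE: `M_w = M/2`, `L_lip = 2M`), and residual `‖g₀‖_W ≤ eta`: the closed `E`-ball of radius `rE` about `0` contains EXACTLY ONE solution of
`δ = −S(g₀ + Qδδ)`.  (MODEL; interval data and the instantiation are hypotheses; shows that the assembly may use `L²_w` as pivot space — no dual.) [folklore] -/
theorem existsUnique_fixedPoint_of_row_w {W : Type*} [NormedAddCommGroup W] [NormedSpace ℝ W]
    (S : W →L[ℝ] E) (Q : E →L[ℝ] E →L[ℝ] W) (g₀ : W) {Mw : ℝ} (hMw : 0 ≤ Mw)
    (hS : ∀ g, ‖S g‖ ≤ ((KNw / (1 - KNw * epsN) : ℚ) : ℝ) * ‖g‖) (hQ : ∀ u v, ‖Q u v‖ ≤ Mw * ‖u‖ * ‖v‖)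
    (hLlip : 4 * Mw ≤ (Llip : ℝ)) (hη : ‖g₀‖ ≤ (eta : ℝ)) :
    ∃ δ ∈ closedBall (0 : E) (rE : ℝ), δ = -S (g₀ + Q δ δ) ∧
      ∀ δ' ∈ closedBall (0 : E) (rE : ℝ), δ' = -S (g₀ + Q δ' δ') → δ' = δ := by
  set Kw : ℚ := KNw / (1 - KNw * epsN) with hKw
  have hKw0 : (0 : ℝ) ≤ (Kw : ℝ) := by have h := Kw_pos; rw [hKw]; exact_mod_cast h.le
  have hself0 : (Kw : ℝ) * ((eta : ℝ) + (Llip : ℝ) / 4 * (rE : ℝ) ^ 2) ≤ (rE : ℝ) := by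
    have h := Kw_selfMap_le; rw [hKw]; exact_mod_cast h
  have hwin0 : (rE : ℝ) * (Kw : ℝ) * ((Llip : ℝ) / 2) < 1 := by
    have h := Kw_window_lt_one; rw [hKw]; exact_mod_cast h
  have hrE0 : (0 : ℝ) ≤ (rE : ℝ) := by norm_num [rE]
  have hg0 : 0 ≤ ‖g₀‖ := norm_nonneg _
  -- monotonicity in (M, η)
  have hself : (Kw : ℝ) * (‖g₀‖ + Mw * (rE : ℝ) ^ 2) ≤ (rE : ℝ) := by
    refine le_trans (mul_le_mul_of_nonneg_left ?_ hKw0) hself0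
    have : Mw * (rE : ℝ) ^ 2 ≤ (Llip : ℝ) / 4 * (rE : ℝ) ^ 2 := mul_le_mul_of_nonneg_right (by linarith) (sq_nonneg _)
    linarith
  have hr' : (rE : ℝ) * (Kw : ℝ) * (2 * Mw) < 1 := by
    refine lt_of_le_of_lt ?_ hwin0
    exact mul_le_mul_of_nonneg_left (by linarith) (mul_nonneg hrE0 hKw0)
  exact existsUnique_fixedPoint_quadratic_of_selfMap S Q g₀ hKw0 hMw hS hQ le_rfl hrE0 hself hr'

end CertificateViscousSheetR
end Summit.NavierStokesRegularity.OSWSelfSimilar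

end
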